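import Summits.Langlands.Langlands.Theses.CMRestImageLocusSplit
import Literature.NumberTheory.Automorphic.CaraianiNewtonModularity
/-! BC3 birth skeleton for crux `HigherCMDegreeWitnessAutomorphy` (CMHIGH) of node/route `CMRestImageLocusSplit` (lens-5 g18): 5 named stubs (sorry) + ONE closed composition `HigherCMDegreeWitnessAutomorphy_proof` (real proof below the `have` lines). POST-BIRTH form: imports the route file and concludes the ROUTE decl by name (elaborates once Theses/CMRestImageLocusSplit.lean exists). -/
set_option linter.dupNamespace false
set_option linter.unusedVariables false
open scoped BigOperators Topology Manifold Classical MeasureTheory ProbabilityTheory Matrix InnerProductSpace ComplexConjugate ContinuousMap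
open Filter Set Function TopologicalSpace MeasureTheory
-- SKELETON SHAPE (writer-1 WORD (A)(61), bus L1461): ONE closed theorem `<Crux>_proof : <crux decl>` whose `have` lines invoke the sorried stubs; no stub is typed `… → <crux decl>`.
namespace Summit.Langlands.Langlands.Cruxes.HigherCMDegreeWitnessAutomorphy.Birth

/-- Integral-model transfer (routine on paper, M-sized in Lean): a field-model imaginary-quadratic elliptic sandwich witness E/K₀ yields an INTEGRAL one E'/𝓞_{K₀} (clear denominators by an admissible change of variables u ∈ K₀^×; ρ_{E',ℓ} ≅ ρ_{E,ℓ} so the trace sandwich is unchanged) — needs the tree's `framedTateGaloisRep` to be invariant under `WeierstrassCurve.VariableChange` at the level of `FramedRep.trace`. -/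
theorem stub_integral_model :
    ∀ (K : Type) [Field K] [NumberField K] (ℓ : ℕ) [Fact ℓ.Prime] (ρ : Literature.NumberTheory.GaloisRepresentations.FramedGaloisRep K (PadicAlgCl ℓ) 2), (∃ (L : Type) (_ : Field L) (_ : NumberField L) (_ : Algebra K L), IsGalois K L ∧ IsSolvable (L ≃ₐ[K] L) ∧ ∃ (K₀ : Type) (_ : Field K₀) (_ : NumberField K₀) (_ : Algebra K₀ L), IsGalois K₀ L ∧ IsSolvable (L ≃ₐ[K₀] L) ∧ NumberField.IsCMField K₀ ∧ Module.finrank ℚ K₀ = 2 ∧ ∃ (E : WeierstrassCurve K₀) (_ : E.IsElliptic) (χ : Literature.NumberTheory.GaloisRepresentations.FramedGaloisRep L (PadicAlgCl ℓ) 1), ∀ g : Field.absoluteGaloisGroup L, Literature.NumberTheory.GaloisRepresentations.FramedRep.trace (ρ.restrictField L) g = Literature.NumberTheory.GaloisRepresentations.FramedRep.trace χ g * Literature.NumberTheory.GaloisRepresentations.FramedRep.trace ((E.framedTateGaloisRep ℓ).restrictField L) g) → (∃ (L : Type) (_ : Field L) (_ : NumberField L) (_ : Algebra K L), IsGalois K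 L ∧ IsSolvable (L ≃ₐ[K] L) ∧ ∃ (K₀ : Type) (_ : Field K₀) (_ : NumberField K₀) (_ : Algebra K₀ L), IsGalois K₀ L ∧ IsSolvable (L ≃ₐ[K₀] L) ∧ NumberField.IsCMField K₀ ∧ Module.finrank ℚ K₀ = 2 ∧ ∃ (E : WeierstrassCurve (NumberField.RingOfIntegers K₀)) (_ : (E.baseChange K₀).IsElliptic) (χ : Literature.NumberTheory.GaloisRepresentations.FramedGaloisRep L (PadicAlgCl ℓ) 1), ∀ g : Field.absoluteGaloisGroup L, Literature.NumberTheory.GaloisRepresentations.FramedRep.trace (ρ.restrictField L) g = Literature.NumberTheory.GaloisRepresentations.FramedRep.trace χ g * Literature.NumberTheory.GaloisRepresentations.FramedRep.trace (((E.baseChange K₀).framedTateGaloisRep ℓ).restrictField L) g) := by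
  sorry

/-- CMHIGH at E-level (the declared residual's content): every integral E (Δ ≠ 0) over every CM field F of degree ≠ 2 is modular (tree sense).  Known: potential modularity (ACC+18 / BCGP21), a positive proportion (AKT23, Whitmore), density-one statements (CN Thm 1.2) [corpus:paper-arxiv-2301.10509 p3]; open in general (TaylorWilesNumericalCoincidence: l₀ > 0 over CM fields is exactly what the 10-author method overcomes only under residual conditions). -/
theorem stub_cm_high :
    ∀ (F : Type) [Field F] [NumberField F], NumberField.IsCMField F → Module.finrank ℚ F ≠ 2 → ∀ E : WeierstrassCurve (NumberField.RingOfIntegers F), E.Δ ≠ 0 → Literature.NumberTheory.Automorphic.IsModularEllipticCurve F E := by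
  sorry

/-- TRANY = host item `EllipticDegreeLadder.EllipticTransportAnyBase` (stmt-Langlands-31038, support · PRINT) BY NAME — the any-signature elliptic-sandwich transport assuming ALL curves over 𝓞_{K₀} modular; one proof closes both. -/
theorem stub_trany :
    Summit.Langlands.Langlands.Theses.EllipticDegreeLadder.EllipticTransportAnyBase := by
  sorry

/-- W⁺|₂ = host item `EllipticDegreeLadder.SatakeAvatarExistence` (stmt-Langlands-17415) AT n = 2, text VERBATIM the first antecedent of TRANY 31038 / ETP: every L-algebraic cuspidal π on GL₂/K has an irreducible ℓ-adic Galois avatar matching its Satake parameters a.e. (HLTT/Scholze + purity). `fun K _ _ hcpt π hL ℓ _ ι => h17415 K 2 hcpt two_pos π hL ℓ ι` closes it from the host item. -/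
theorem stub_avatar2 :
    ∀ (K : Type) [Field K] [NumberField K] (hcpt : Literature.NumberTheory.Automorphic.isCompact_glFiniteIntegralLevel 2 K) (π : Literature.NumberTheory.Automorphic.CuspidalAutomorphicRepData 2 K hcpt), π.1.IsLAlgebraic → ∀ (ℓ : ℕ) [Fact ℓ.Prime] (ι : PadicAlgCl ℓ ≃+* ℂ), ∃ ρ : Literature.NumberTheory.GaloisRepresentations.FramedGaloisRep K (PadicAlgCl ℓ) 2, ρ.toGaloisRep.IsIrreducible ∧ ∀ᶠ v : IsDedekindDomain.HeightOneSpectrum (NumberField.RingOfIntegers K) in Filter.cofinite, SatakeFrobCompatibleAt ι π.1 ρ v := by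
  sorry

/-- R1 = host item `EllipticDegreeLadder.RankOneAutomorphy` (stmt-Langlands-24805) BY NAME (cross-route by-name stub, tree precedent `stub_pairLBoundaryJS : AnalyticDescent.PairLBoundaryJS`) — automorphy of pinned-geometric ℓ-adic characters (class field theory + Weil); one proof closes both. -/
theorem stub_rankOne :
    Summit.Langlands.Langlands.Theses.EllipticDegreeLadder.RankOneAutomorphy := by
  sorry

/-- composition (real proof, no sorry outside the stubs): the stubs imply the cell. -/
theorem HigherCMDegreeWitnessAutomorphy_proof :
    Summit.Langlands.Langlands.Theses.CMRestImageLocusSplit.HigherCMDegreeWitnessAutomorphy := by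
  have hI : (∀ (K : Type) [Field K] [NumberField K] (ℓ : ℕ) [Fact ℓ.Prime] (ρ : Literature.NumberTheory.GaloisRepresentations.FramedGaloisRep K (PadicAlgCl ℓ) 2), (∃ (L : Type) (_ : Field L) (_ : NumberField L) (_ : Algebra K L), IsGalois K L ∧ IsSolvable (L ≃ₐ[K] L) ∧ ∃ (K₀ : Type) (_ : Field K₀) (_ : NumberField K₀) (_ : Algebra K₀ L), IsGalois K₀ L ∧ IsSolvable (L ≃ₐ[K₀] L) ∧ NumberField.IsCMField K₀ ∧ Module.finrank ℚ K₀ = 2 ∧ ∃ (E : WeierstrassCurve K₀) (_ : E.IsElliptic) (χ : Literature.NumberTheory.GaloisRepresentations.FramedGaloisRep L (PadicAlgCl ℓ) 1), ∀ g : Field.absoluteGaloisGroup L, Literature.NumberTheory.GaloisRepresentations.FramedRep.trace (ρ.restrictField L) g = Literature.NumberTheory.GaloisRepresentations.FramedRep.trace χ g * Literature.NumberTheory.GaloisRepresentations.FramedRep.trace ((E.framedTateGaloisRep ℓ).restrictField L) g) → (∃ (L : Type) (_ : Field L) (_ : NumberField L) (_ : Algebra K L), IsGalois K L ∧ IsSolvable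 (L ≃ₐ[K] L) ∧ ∃ (K₀ : Type) (_ : Field K₀) (_ : NumberField K₀) (_ : Algebra K₀ L), IsGalois K₀ L ∧ IsSolvable (L ≃ₐ[K₀] L) ∧ NumberField.IsCMField K₀ ∧ Module.finrank ℚ K₀ = 2 ∧ ∃ (E : WeierstrassCurve (NumberField.RingOfIntegers K₀)) (_ : (E.baseChange K₀).IsElliptic) (χ : Literature.NumberTheory.GaloisRepresentations.FramedGaloisRep L (PadicAlgCl ℓ) 1), ∀ g : Field.absoluteGaloisGroup L, Literature.NumberTheory.GaloisRepresentations.FramedRep.trace (ρ.restrictField L) g = Literature.NumberTheory.GaloisRepresentations.FramedRep.trace χ g * Literature.NumberTheory.GaloisRepresentations.FramedRep.trace (((E.baseChange K₀).framedTateGaloisRep ℓ).restrictField L) g)) := stub_integral_model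
  have hE : (∀ (F : Type) [Field F] [NumberField F], NumberField.IsCMField F → Module.finrank ℚ F ≠ 2 → ∀ E : WeierstrassCurve (NumberField.RingOfIntegers F), E.Δ ≠ 0 → Literature.NumberTheory.Automorphic.IsModularEllipticCurve F E) := stub_cm_high
  have hTr : (Summit.Langlands.Langlands.Theses.EllipticDegreeLadder.EllipticTransportAnyBase) := stub_trany
  have hW : (∀ (K : Type) [Field K] [NumberField K] (hcpt : Literature.NumberTheory.Automorphic.isCompact_glFiniteIntegralLevel 2 K) (π : Literature.NumberTheory.Automorphic.CuspidalAutomorphicRepData 2 K hcpt), π.1.IsLAlgebraic → ∀ (ℓ : ℕ) [Fact ℓ.Prime] (ι : PadicAlgCl ℓ ≃+* ℂ), ∃ ρ : Literature.NumberTheory.GaloisRepresentations.FramedGaloisRep K (PadicAlgCl ℓ) 2, ρ.toGaloisRep.IsIrreducible ∧ ∀ᶠ v : IsDedekindDomain.HeightOneSpectrum (NumberField.RingOfIntegers K) in Filter.cofinite, SatakeFrobCompatibleAt ι π.1 ρ v) := stub_avatar2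
  have h1 : (Summit.Langlands.Langlands.Theses.EllipticDegreeLadder.RankOneAutomorphy) := stub_rankOne
  intro K _ _ hcpt ℓ _ ι ρ hirr hgeo htw hP
  obtain ⟨-, -, ⟨L, _, _, _, hgal, hsol, K₀, _, _, _, hgal₀, hsol₀, hcm, E, hEll, χ, hvia⟩, hnwiq⟩ := hP
  have hd : Module.finrank ℚ K₀ ≠ 2 := fun hd2 =>
    hnwiq (hI K ℓ ρ ⟨L, inferInstance, inferInstance, inferInstance, hgal, hsol, K₀, inferInstance, inferInstance, inferInstance, hgal₀, hsol₀, hcm, hd2, E, hEll, χ, hvia⟩)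
  exact hTr hW h1 K hcpt ℓ ι ρ hirr hgeo htw L hgal hsol K₀ hgal₀ hsol₀ E χ hvia (fun E' hΔ => hE K₀ hcm hd E' hΔ)

end Summit.Langlands.Langlands.Cruxes.HigherCMDegreeWitnessAutomorphy.Birth
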